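import Literature.MathematicalPhysics.QuantumFieldTheory.Balaban1983to89.B9CoReadingCoordsHolder
import Literature.MathematicalPhysics.QuantumFieldTheory.Balaban1983to89.B9CoReadingCoordsH
import Literature.MathematicalPhysics.QuantumFieldTheory.Balaban1983to89.B9Thm312WholeHHolderNbr

/-!
# `Balaban1983to89.B9CoReadingCoordsHHolder` — the HÖLDER MEMBER ‖ζ∇_U H(·,y′)‖_α of the (3.133) reading of an H-letter: n06-l's
# neighbourhood-sited co-reading `CoReadsHHolderNbr` HOLDS AT THE COORDINATE PINS (def-Y's reading `hKernelOfOp`, n06-d's model `∇_U ∘ H` in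
# κ-fold real coordinates and n06-d's Hölder probes `holderProbesK`), for EVERY H-letter and EVERY configuration `U`

T. Bałaban, *Propagators for lattice gauge theories in a background field*, Commun. Math. Phys. **99** (1985) 389–434
[`Balaban1985BackgroundPropagators`, "B9"]; [4] = T. Bałaban, *Propagators and renormalization transformations for lattice gauge
theories. II*, Commun. Math. Phys. **96** (1984) 223–250 [`Balaban1984PropagatorsII`].

statement-level skeleton of published theorems with citation tags; proofs where landed; nothing here is a claim about the
Yang–Mills mass gap

THE PRINTED LOCI.  (3.133) p. 422: *"|H(x,y′)|, |(∇_UH)(x,y′)|, ‖ζ∇H(·,y′)‖_β ≦ O(1)[…](L^{j′}η)^{−d} e^{−(1/2)δ₁d(y,y′)} for x ∈ Δ(y), or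
ζ ∈ C₀^∞(Δ̃(y)), y ∈ Λ_j, y′ ∈ Λ_{j′}"* (third member); (3.40) p. 397 (the covariant Hölder quotient *"|U(Γ_{x,x′})A(x′) − A(x)| ∕ |x − x′|^α"* over
pairs in Δ̃(y)); (3.126) p. 420 (H from functions on the coarse lattice to functions on the fine lattice); [4] (2.150) p. 249 (the volume normalisation
`(L^{j′}η)^{−d}` of kernel entries), (2.51)–(2.52) p. 232 (block majorants), (2.137) p. 247 (the pair parameter).

WHY THIS FILE (seat n06-l g8, the SCHEMA OWNER of `B9Thm312WholeHHolderNbr.CoReadsHHolderNbr`; n06-d's `B9CoReadingCoordsHolder` names it a sequel).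
Row 20 of the N06 certificate (Theorem 3.12; rows-20–21 pin face `…N06Thm312313AtPinsPairM`, p538837) still DISPLAYS the binder
`hHCN : CoReadsHHolderNbr ((ops) x).H U (d+1) (𝔭A x) 2 blkZ (D U ∘ₗ Hm U) ∧ (same for H₁)` — the co-reading of the HÖLDER member `HKernel.h` of def-Y's
(3.133) reading `hKernelOfOp` (`.h U α (.inr ζ) y′ = sup_{‖E‖≤1} sup_ν holderQB (U(Γ)) α ζ (∇_{U,ν} H(U)(δ_{y′} ⊗ E)) · (vol y′)⁻¹`) by the model of
`∇_U ∘ H` through a probe family `𝔭A`.  After `B9CoReadingCoords` ((3.42)), `…Glob` ((3.47)), `…L2*` ((3.46)), `B9CoReadingCoordsH` ((3.133) sup members,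
`coRealizesHRel_hKernel_coords_zero ∕ _one`) and `B9CoReadingCoordsHolder` ((3.43), the probes `holderProbesK` and the product rule
`holderQB_le_of_probes`), THIS FILE proves that schema at the pins — so that `hHCN` becomes a `have` once `𝔭A := holderProbesK …` — and thereby
records that the Nbr species of the H-Hölder co-reading IS dischargeable at the record (the hygiene point of the located obstructions (O1)∕(O2)∕(O4′)
against earlier co-reading species).
* §1 ★ `holderQB_deltaY_le_of_probes` — n06-d's PRODUCT RULE transported from bond→bond families at `J ⊗ E` to MIXED families
  `T ν : (IBondY i → 𝔸) →ₗ[ℝ] (FBondY i → 𝔸)` at the coarse input `δ_{y′} ⊗ E`, by a SAMPLING REDUCTION (`T″ ν := T ν ∘ P`, `P f c := indY y′ c • f x₀`,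
  `J₀ := δ_{x₀}`: `T″ ν (J₀ ⊗ E) = T ν (δ_{y′} ⊗ E)` and `coordOpK T″ (evDiagK J₀) = coordOpKH T (evDiagK (indY y′))`); an empty fine-bond set is trivial.
* §2 ★★ `coReadsHHolderNbr_hKernel_coords` — `CoReadsHHolderNbr (hKernelOfOp i B cfg O par) U₁ (d+1) (holderProbesK i b B cfg par bI) r (blkHK i)
  (DcoK … U₁ ∘ₗ HcoK … O U₁)` for every H-letter `O`, every `U₁`, every real basis `b`, every `r ≥ 2`, given `bI` 1-faithful: the admissible test vector is
  the diagonal evaluation of the indicator of `y′` (`evDiagK_indY_test`), the model identity is `DcoK_comp_HcoK`, the constant is `c·(L^{j′}η)^{D}` and the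
  reading's `(vol y′)⁻¹` cancels it (`mul_vol_inv_eq`).
* §3 ★ `bond_coReadsHHolderNbr_of_pins` — the same under the certificate's pin equations (`𝔭 = holderProbesK …`, `blkZ = blkHK`, `Hm = HcoK … O U₁`,
  `D = DcoK … U₁`), radius 2: each conjunct of `hHCN x U` by one application (letters `H`, `H₁` of the record, `par := parB`, `cfg := id`).
HONEST SCOPE.  Finite-dimensional bookkeeping over def-Y's reading and n06-d's coordinate gadgets (generic `B : B9.Backgrounds`, `cfg` — no class, no
`bg9Y`); nothing of [B9] or [4] is asserted (the (3.133) BOUND itself stays the displayed walk-expansion schemas `LettersH ∕ LettersHH` + the step); the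
input co-readings `InputReadsFam` (`hIR hIRA hIF`) are NOT treated here (n06-d's sequel).  COUNT-NEUTRAL; N06 NOT discharged; one finite 𝕋^{d+1}
programme at fixed ε — nothing continuum, nothing about the mass gap.  Cell `pub-ymgap` (HUMAN RULING D-0062), Track A node N06 [B9], N06-ASSIGNMENT v1
row 20 (bundle F7), seat `pub-ymgap-dag-n06-l` (g8), 2026-08-27.
-/

noncomputable section

namespace Literature.MathematicalPhysics.QuantumFieldTheory.Balaban1983to89.B9CoReadingCoordsHHolder

open B6GlobalChartV1 (PV blkV1)
open B6Geom246MultiLevelTorus (geomT)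
open B6Ineq2142KLevelV1 (β)
open B6KLevelCensusIndexV1 (KIdx kGeo)
open B9GeoNormsKLevelV1 (geo9K geo9K_cutH_nonneg)
open B9Thm39ReadingCoords (cR39)
open B9CoReadingCoords (evDiagK coordOpK coordOpK_evDiagK cdBₗ cdBₗ_apply XBK DcoK)
open B9CoReadingCoordsH (coordOpKH coordOpKH_evDiagK XHK blkHK indY liftY_indY HcoK DcoK_comp_HcoK vol_inv_nonneg mul_vol_inv_eq
  evDiagK_indY_test)
open B9CoReadingCoordsHolder (PK blkPK probeK wK w₀K holderProbesK holderQB_le_of_probes)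
open B9RWSums343Holder (HolderProbes)
open B9Thm312WholeHHolderNbr (CoReadsHHolderNbr)
open B6Cor28PrintedKLevelV1 (vol)
open Node00 (FBondY IBondY CfgY BallY liftY liftY_apply deltaY holderQB hKernelOfOp BondParY cdB iSup_ball_le)

variable {d ℓ : ℕ} {hd : 1 ≤ d + 1} {hL : Odd (ℓ + 1) ∧ 1 < ℓ + 1} {b₀ b₁ : ℝ}
variable {𝔸 : Type} [NormedRing 𝔸] [NormedAlgebra ℂ 𝔸]
variable {κ : Type} [Fintype κ] [DecidableEq κ]

/-! ## §1 ★ The product rule for a MIXED family at a coarse delta input (sampling reduction to `holderQB_le_of_probes`) -/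

section Mixed

variable [CompleteSpace 𝔸] (i : KIdx d ℓ hd hL b₀ b₁) (b : Module.Basis κ ℝ 𝔸) [FiniteDimensional ℝ 𝔸]
variable {bI : FBondY i → IBondY i}

/-- ★ **THE PRODUCT RULE FOR THE COVARIANT HÖLDER QUOTIENT OF `ζ · (T ν (δ_{y′} ⊗ E))`, `T` A MIXED FAMILY (coarse input, fine output), READ THROUGH
THE PROBES.**  Let `bI` be 1-faithful and `2 ≤ r`; let the transporters `par U` be arbitrary units; let `ζ` be supported within block distance 1 of `β y`.
If every pair ∕ point probe of the scaled mixed coordinate model `cR39 b • coordOpKH b T` at the diagonal evaluation of the indicator of `y′`, anchored within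
distance `r` of `y`, is `≤ c` in absolute value, then for `‖E‖ ≤ 1` and every slot `ν`: `holderQB (ζ · T ν (δ_{y′} ⊗ E)) ≤ c · (|ζ| + ‖ζ‖^ξ_α)`.
Proof: for a fine bond `x₀`, the bond→bond family `T″ ν := T ν ∘ P` with the sampling map `P f := (c ↦ indY y′ c • f x₀)` and `J₀ := δ_{x₀}` has
`T″ ν (J₀ ⊗ E) = T ν (δ_{y′} ⊗ E)` and the same coordinate vector, so n06-d's `holderQB_le_of_probes` applies verbatim; with no fine bond the quotient is `0`.
[cite: Balaban1985BackgroundPropagators, (3.40) p.397 + (3.133) p.422 (third member); Balaban1984PropagatorsII, (2.51)–(2.52) p.232 + (2.137) p.247] -/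
theorem holderQB_deltaY_le_of_probes
    (hβ1 : ∀ x : FBondY i, (geomT i.D).dist (β i.hN i.D i.hk (bI x)) (blkV1 i.hN i.D x) ≤ 1) {r : ℝ} (hr : 2 ≤ r)
    (par : BondParY 𝔸 i) (U : CfgY 𝔸 i) (T : Fin (d + 1) → (IBondY i → 𝔸) →ₗ[ℝ] (FBondY i → 𝔸)) (y' : IBondY i) (α : ℝ) (z : FBondY i → ℝ)
    (y : IBondY i) {c : ℝ} (hc : 0 ≤ c)
    (hcut : ∀ f, z f ≠ 0 → (geomT i.D).dist (blkV1 i.hN i.D f) (β i.hN i.D i.hk y) ≤ 1)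
    (hP : ∀ p : PK (FBondY i) (Fin (d + 1)) κ, (geomT i.D).dist (β i.hN i.D i.hk (blkPK bI p)) (β i.hN i.D i.hk y) ≤ r →
      |probeK b (fun x x' : FBondY i => par U x.src x'.src) (wK i α) (w₀K i α) ((cR39 b • coordOpKH b T) (evDiagK (indY i y'))) p| ≤ c)
    (E : BallY 𝔸) (ν : Fin (d + 1)) :
    holderQB i (par U) α z (T ν (deltaY y' (E : 𝔸))) ≤ c * (kGeo i).cutH α z := by
  classical
  have h0 : 0 ≤ c * (kGeo i).cutH α z := mul_nonneg hc (geo9K_cutH_nonneg i α (Sum.inr z))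
  rcases isEmpty_or_nonempty (FBondY i) with hemp | ⟨⟨x₀⟩⟩
  · -- no fine bonds: the Hölder quotient is a sup over the empty set of pairs
    have hq : holderQB i (par U) α z (T ν (deltaY y' (E : 𝔸))) = 0 := by
      unfold holderQB
      exact Real.iSup_of_isEmpty _
    rw [hq]
    exact h0
  · -- the sampling reduction to a bond→bond family
    set J₀ : FBondY i → ℝ := fun f => if f = x₀ then 1 else 0 with hJ₀
    set P : (FBondY i → 𝔸) →ₗ[ℝ] (IBondY i → 𝔸) :=
      LinearMap.pi (fun cc : IBondY i => (indY i y' cc) • (LinearMap.proj x₀ : (FBondY i → 𝔸) →ₗ[ℝ] 𝔸)) with hPdef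
    have hPJ : ∀ E' : 𝔸, P (liftY J₀ E') = deltaY y' E' := by
      intro E'
      rw [← liftY_indY i y' E']
      funext cc
      rw [hPdef, LinearMap.pi_apply, LinearMap.smul_apply, LinearMap.proj_apply, liftY_apply, liftY_apply, hJ₀]
      simp only [if_true, Complex.ofReal_one, one_smul]
      exact (Complex.coe_smul (indY i y' cc) E').symm
    set T'' : Fin (d + 1) → (FBondY i → 𝔸) →ₗ[ℝ] (FBondY i → 𝔸) := fun μ => T μ ∘ₗ P with hT''
    have hTJ : ∀ (μ : Fin (d + 1)) (E' : 𝔸), T'' μ (liftY J₀ E') = T μ (deltaY y' E') := fun μ E' => by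
      rw [hT'', LinearMap.comp_apply, hPJ]
    have hvec : (cR39 b • coordOpK b T'') (evDiagK J₀) = (cR39 b • coordOpKH b T) (evDiagK (indY i y')) := by
      funext p
      simp only [LinearMap.smul_apply, Pi.smul_apply, coordOpK_evDiagK, coordOpKH_evDiagK, hTJ, liftY_indY]
    have key := holderQB_le_of_probes i b hβ1 hr (par U) T'' J₀ α z y hc hcut (fun p hp => by rw [hvec]; exact hP p hp) E ν
    rwa [hTJ] at key

end Mixed

/-! ## §2 ★★ The H-Hölder co-reading `CoReadsHHolderNbr` of `hKernelOfOp` on the coordinate model with the Hölder probes -/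

section CoReading

variable [CompleteSpace 𝔸] [FiniteDimensional ℝ 𝔸] (i : KIdx d ℓ hd hL b₀ b₁) (b : Module.Basis κ ℝ 𝔸)
variable (B : B9.Backgrounds) (cfg : B.Cfg → CfgY 𝔸 i) (O : CfgY 𝔸 i → (IBondY i → 𝔸) →ₗ[ℂ] (FBondY i → 𝔸)) (par : BondParY 𝔸 i) (U₁ : B.Cfg)
variable {bI : FBondY i → IBondY i}

/-- ★★ **`CoReadsHHolderNbr (hKernelOfOp i B cfg O par) U₁ (d+1) (holderProbesK i b B cfg par bI) r (blkHK i) (DcoK … U₁ ∘ₗ HcoK … O U₁)`** for EVERY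
H-letter `O : (coarse → 𝔸) →ₗ (fine → 𝔸)`, EVERY `U₁` (no unitarity of the transporters), every real basis `b`, every radius `r ≥ 2`, given `bI` 1-faithful:
the Hölder member `sup_{‖E‖≤1} sup_ν holderQB (U(Γ)) α ζ (∇_{U,ν} O(U)(δ_{y′} ⊗ E)) · (vol y′)⁻¹` of def-Y's (3.133) reading is OBSERVED by the probes within
`r` of `y` on the model of `∇_U ∘ O(U)` at the admissible test vector `evDiagK (indY y′)`; the schema's `(L^{j′}η)^{D}` is cancelled by the reading's
`(vol y′)⁻¹ = (L^{j′}η)^{−D}`. [cite: Balaban1985BackgroundPropagators, (3.133) p.422 (third member) + (3.40) p.397 + (3.126) p.420; Balaban1984PropagatorsII, (2.150) p.249, (2.51)–(2.52) p.232] -/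
theorem coReadsHHolderNbr_hKernel_coords [Fintype (geo9K i).Site]
    (hβ1 : ∀ x : FBondY i, (geomT i.D).dist (β i.hN i.D i.hk (bI x)) (blkV1 i.hN i.D x) ≤ 1) {r : ℝ} (hr : 2 ≤ r) :
    CoReadsHHolderNbr (hKernelOfOp i B cfg O par) U₁ (d + 1) (holderProbesK i b B cfg par bI) r (blkHK (κ := κ) i)
      (DcoK i b B cfg U₁ ∘ₗ HcoK i b B cfg O U₁) := by
  refine ⟨fun α ζ => geo9K_cutH_nonneg i α ζ, ?_⟩
  intro α ζ y y' c hc hcut hb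
  have h0 : 0 ≤ c * (geo9K i).cutH α ζ := mul_nonneg hc (geo9K_cutH_nonneg i α ζ)
  cases ζ with
  | inl zz => exact h0
  | inr zz =>
      have hC : 0 ≤ c * (geo9K i).len y' ^ (((d + 1 : ℕ) : ℝ)) :=
        mul_nonneg hc (Real.rpow_nonneg (B6KLevelCensusIndexV1.len_pos i y').le _)
      -- the admissible test vector of the schema: the diagonal evaluation of the indicator of y′ (supported on the input fibre of y′, sup ≤ 1)
      have hPY := hb _ (evDiagK_indY_test i y').1 (evDiagK_indY_test i y').2
      rw [DcoK_comp_HcoK] at hPY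
      show (⨆ E : BallY 𝔸, ⨆ ν : Fin (d + 1),
          holderQB i (par (cfg U₁)) α zz (cdB i (cfg U₁) ν (O (cfg U₁) (deltaY y' (E : 𝔸)))) * (vol i y')⁻¹) ≤ c * (kGeo i).cutH α zz
      have h0' : 0 ≤ c * (kGeo i).cutH α zz := h0
      refine iSup_ball_le (fun E => Real.iSup_le (fun ν => ?_) h0') h0'
      have key := holderQB_deltaY_le_of_probes i b hβ1 hr par (cfg U₁)
        (fun ν => cdBₗ i (cfg U₁) ν ∘ₗ (O (cfg U₁)).restrictScalars ℝ) y' α zz y hC hcut hPY E ν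
      have key' : holderQB i (par (cfg U₁)) α zz (cdB i (cfg U₁) ν (O (cfg U₁) (deltaY y' (E : 𝔸)))) ≤
          c * (geo9K i).len y' ^ (((d + 1 : ℕ) : ℝ)) * (kGeo i).cutH α zz := by
        simpa only [LinearMap.comp_apply, cdBₗ_apply, LinearMap.coe_restrictScalars] using key
      have hcut0 : 0 ≤ (kGeo i).cutH α zz := geo9K_cutH_nonneg i α (Sum.inr zz)
      calc holderQB i (par (cfg U₁)) α zz (cdB i (cfg U₁) ν (O (cfg U₁) (deltaY y' (E : 𝔸)))) * (vol i y')⁻¹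
          ≤ c * (geo9K i).len y' ^ (((d + 1 : ℕ) : ℝ)) * (kGeo i).cutH α zz * (vol i y')⁻¹ :=
            mul_le_mul_of_nonneg_right key' (vol_inv_nonneg i y')
        _ = c * (geo9K i).len y' ^ (((d + 1 : ℕ) : ℝ)) * (vol i y')⁻¹ * (kGeo i).cutH α zz := by ring
        _ = c * (kGeo i).cutH α zz := by rw [mul_vol_inv_eq i y' c]

end CoReading

/-! ## §3 ★ Under the certificate's pin equations (radius 2) -/

section Pins

variable [CompleteSpace 𝔸] [FiniteDimensional ℝ 𝔸] (i : KIdx d ℓ hd hL b₀ b₁) (b : Module.Basis κ ℝ 𝔸)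
variable (B : B9.Backgrounds) (cfg : B.Cfg → CfgY 𝔸 i) (O : CfgY 𝔸 i → (IBondY i → 𝔸) →ₗ[ℂ] (FBondY i → 𝔸)) (par : BondParY 𝔸 i) (U₁ : B.Cfg)
variable {bI : FBondY i → IBondY i}

/-- ★ **THE H-HÖLDER CO-READING UNDER THE PINS, RADIUS 2**: for a probe family pinned to the Hölder probes of the coordinate model (`𝔭 = holderProbesK …`),
the input block map `blkZ = blkHK`, and walk-letter operators `Hm = HcoK … O U₁`, `D = DcoK … U₁` (the pin equations displayed by the N06 certificate),
`CoReadsHHolderNbr (hKernelOfOp i B cfg O par) U₁ (d+1) 𝔭 2 blkZ (D ∘ₗ Hm)` HOLDS — each conjunct of the rows-20–21 binder `hHCN` (letters `H`, `H₁`) by one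
application. [cite: Balaban1985BackgroundPropagators, (3.133) p.422 (third member) + (3.40) p.397; Balaban1984PropagatorsII, (2.150) p.249, (2.51)–(2.52) p.232] -/
theorem bond_coReadsHHolderNbr_of_pins [Fintype (geo9K i).Site]
    (hβ1 : ∀ x : FBondY i, (geomT i.D).dist (β i.hN i.D i.hk (bI x)) (blkV1 i.hN i.D x) ≤ 1)
    {𝔭 : HolderProbes (geo9K i) B (XBK κ i) (XBK κ i) (PK (FBondY i) (Fin (d + 1)) κ) (PK (FBondY i) (Fin (d + 1)) κ)}
    {blkZ : XHK κ i → IBondY i} {Hm : (XHK κ i → ℝ) →ₗ[ℝ] (XBK κ i → ℝ)} {D : (XBK κ i → ℝ) →ₗ[ℝ] (XBK κ i → ℝ)}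
    (h𝔭 : 𝔭 = holderProbesK i b B cfg par bI) (hblkZ : blkZ = blkHK i) (hHm : Hm = HcoK i b B cfg O U₁) (hD : D = DcoK i b B cfg U₁) :
    CoReadsHHolderNbr (hKernelOfOp i B cfg O par) U₁ (d + 1) 𝔭 2 blkZ (D ∘ₗ Hm) := by
  subst h𝔭 hblkZ hHm hD
  exact coReadsHHolderNbr_hKernel_coords i b B cfg O par U₁ hβ1 le_rfl

end Pins

end Literature.MathematicalPhysics.QuantumFieldTheory.Balaban1983to89.B9CoReadingCoordsHHolder

end
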